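import Literature.Geometry.Riemannian.MetricFlowConcentration
import Mathlib.Topology.Order.IsLUB
import HarnessLib

/-!
# The mass distribution function of a metric measure space (Bamler 2023, §2.5, Definition and
# Lemma)

R. Bamler, *Compactness theory of the space of super Ricci flows*, Invent. Math. 233 (2023), §2.5,
Definition (mass distribution function): *"We define the mass distribution function at scale
`r > 0`, `b^{(X,d,μ)}_r : (0, 1] → (0, 1]`, of a metric measure space `(X, d, μ)` by
`b^{(X,d,μ)}_r(ε) := sup {δ > 0 : μ({x ∈ X : μ(D(x, εr)) < δ}) ≤ ε}` (2.6). Here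
`D(x, εr) := {d(x, ·) ≤ εr}` denotes the closed ball around `x`"*, and the Lemma following it:
*"`b^{(X,d,μ)}_r(ε)` is non-decreasing … The supremum in (2.6) is attained and for any function
`b : (0, 1] → (0, 1]` the condition `b^{(X,d,μ)}_r ≥ b` is equivalent to
`μ({x ∈ X : μ(D(x, εr)) < b(ε)}) ≤ ε` for all `ε ∈ (0, 1]`"*.

We take the supremum in `[0, ∞]` over `δ ≤ 1` (so that `b ≤ 1`, as in the printed range
`(0, 1]`; `δ = 0` is always admissible):

* `thinSet μ ρ δ := {x | μ(D(x, ρ)) < δ}` (measurable: `measurable_measure_closedBall`);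
* `massDistribution μ r ε` — **`b^{(X,d,μ)}_r(ε)`**;
* `massDistribution_le_one`, `massDistribution_mono` (non-decreasing in `ε`),
  `measure_thinSet_massDistribution_le` (**the supremum is attained**; by the continuity of
  measures along monotone unions, valid without measurability assumptions),
  `le_massDistribution_iff` (**the criterion for `b^{(X,d,μ)}_r ≥ b`**).

Everything is proved; no named facts.

## References

* R. H. Bamler, *Compactness theory of the space of super Ricci flows*, Invent. Math. 233 (2023),
  §2.5, Definition (mass distribution function), (2.6), and the Lemma following it. [Bamler2023]
-/

noncomputable section

open Set MeasureTheory Filter Topology Metric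
open scoped ENNReal NNReal

namespace Literature.Geometry.Riemannian

variable {X : Type*} [MetricSpace X] [MeasurableSpace X] [BorelSpace X]

/-! ### Measurability of `x ↦ μ(D(x, ρ))` and the thin sets -/

/-- `x ↦ μ(D(x, ρ))` is measurable for s-finite `μ` on a separable metric space (the section of
the closed set `{d ≤ ρ} ⊆ X × X`). [folklore] -/
theorem measurable_measure_closedBall [SecondCountableTopology X] (μ : Measure X) [SFinite μ]
    (ρ : ℝ) : Measurable fun x : X ↦ μ (closedBall x ρ) := by
  have hS : MeasurableSet {p : X × X | dist p.1 p.2 ≤ ρ} :=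
    (isClosed_le continuous_dist continuous_const).measurableSet
  have h := measurable_measure_prodMk_left (ν := μ) hS
  have heq : ∀ x : X, Prod.mk x ⁻¹' {p : X × X | dist p.1 p.2 ≤ ρ} = closedBall x ρ := fun x ↦ by
    ext y
    simp [mem_closedBall, dist_comm]
  simpa only [heq] using h

/-- **The thin set `{x ∈ X : μ(D(x, ρ)) < δ}`** of Bamler 2023, (2.6).
[cite: Bamler2023, §2.5, Definition (mass distribution function), (2.6)] -/
def thinSet (μ : Measure X) (ρ : ℝ) (δ : ℝ≥0∞) : Set X :=
  {x | μ (closedBall x ρ) < δ}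

omit [BorelSpace X] in
/-- Membership in the thin set. [cite: Bamler2023, §2.5, Definition (mass distribution function), (2.6)] -/
@[simp] theorem mem_thinSet {μ : Measure X} {ρ : ℝ} {δ : ℝ≥0∞} {x : X} :
    x ∈ thinSet μ ρ δ ↔ μ (closedBall x ρ) < δ := Iff.rfl

/-- The thin sets are measurable. [cite: Bamler2023, §2.5, Definition (mass distribution function), (2.6)] -/
theorem measurableSet_thinSet [SecondCountableTopology X] (μ : Measure X) [SFinite μ] (ρ : ℝ)
    (δ : ℝ≥0∞) : MeasurableSet (thinSet μ ρ δ) :=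
  measurableSet_lt (measurable_measure_closedBall μ ρ) measurable_const

omit [BorelSpace X] in
/-- The thin sets increase with `δ`. [cite: Bamler2023, §2.5, proof of the Lemma] -/
theorem thinSet_mono (μ : Measure X) (ρ : ℝ) {δ₁ δ₂ : ℝ≥0∞} (h : δ₁ ≤ δ₂) :
    thinSet μ ρ δ₁ ⊆ thinSet μ ρ δ₂ := fun _ hx ↦ lt_of_lt_of_le hx h

omit [BorelSpace X] in
/-- The thin sets decrease with the radius (Bamler 2023, §2.5, proof of the Lemma, monotonicity:
`μ({μ(D(x, ε₂r)) < δ}) ≤ μ({μ(D(x, ε₁r)) < δ})` for `ε₁ ≤ ε₂`). [cite: Bamler2023, §2.5, proof of the Lemma] -/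
theorem thinSet_anti (μ : Measure X) {ρ₁ ρ₂ : ℝ} (h : ρ₁ ≤ ρ₂) (δ : ℝ≥0∞) :
    thinSet μ ρ₂ δ ⊆ thinSet μ ρ₁ δ := fun _ hx ↦
  lt_of_le_of_lt (measure_mono (closedBall_subset_closedBall h)) hx

omit [BorelSpace X] in
/-- `thinSet μ ρ 0 = ∅`. [cite: Bamler2023, §2.5, Definition (mass distribution function), (2.6)] -/
@[simp] theorem thinSet_zero (μ : Measure X) (ρ : ℝ) : thinSet μ ρ 0 = ∅ := by
  ext x; simp [thinSet]

/-! ### The mass distribution function -/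

/-- **The mass distribution function at scale `r`** (Bamler 2023, §2.5, Definition, (2.6)):
`b^{(X,d,μ)}_r(ε) := sup {δ : μ({x : μ(D(x, εr)) < δ}) ≤ ε}`, the supremum taken in `[0, ∞]`
over `δ ≤ 1` (the printed `b` takes values in `(0, 1]`).
[cite: Bamler2023, §2.5, Definition (mass distribution function), (2.6)] -/
def massDistribution (μ : Measure X) (r ε : ℝ) : ℝ≥0∞ :=
  sSup {δ : ℝ≥0∞ | δ ≤ 1 ∧ μ (thinSet μ (ε * r) δ) ≤ ENNReal.ofReal ε}

omit [BorelSpace X] in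
/-- The admissible set of (2.6) is downward closed. [cite: Bamler2023, §2.5, proof of the Lemma] -/
theorem mem_massDistribution_set_of_le {μ : Measure X} {r ε : ℝ} {δ δ' : ℝ≥0∞}
    (hδ : δ ∈ {δ : ℝ≥0∞ | δ ≤ 1 ∧ μ (thinSet μ (ε * r) δ) ≤ ENNReal.ofReal ε}) (h : δ' ≤ δ) :
    δ' ∈ {δ : ℝ≥0∞ | δ ≤ 1 ∧ μ (thinSet μ (ε * r) δ) ≤ ENNReal.ofReal ε} :=
  ⟨h.trans hδ.1, (measure_mono (thinSet_mono μ _ h)).trans hδ.2⟩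

omit [BorelSpace X] in
/-- Everything strictly below `b^{(X,d,μ)}_r(ε)` is admissible in (2.6).
[cite: Bamler2023, §2.5, proof of the Lemma] -/
theorem mem_massDistribution_set_of_lt {μ : Measure X} {r ε : ℝ} {δ : ℝ≥0∞}
    (h : δ < massDistribution μ r ε) :
    δ ∈ {δ : ℝ≥0∞ | δ ≤ 1 ∧ μ (thinSet μ (ε * r) δ) ≤ ENNReal.ofReal ε} := by
  obtain ⟨a, ha, hδa⟩ := lt_sSup_iff.1 h
  exact mem_massDistribution_set_of_le ha hδa.le

omit [BorelSpace X] in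
/-- `b^{(X,d,μ)}_r(ε) ≤ 1`. [cite: Bamler2023, §2.5, Definition (mass distribution function)] -/
theorem massDistribution_le_one (μ : Measure X) (r ε : ℝ) : massDistribution μ r ε ≤ 1 :=
  sSup_le fun _ h ↦ h.1

omit [BorelSpace X] in
/-- **`b^{(X,d,μ)}_r` is non-decreasing** (Bamler 2023, §2.5, Lemma, first statement), for
`r ≥ 0`. [cite: Bamler2023, §2.5, Lemma (properties of the mass distribution function)] -/
theorem massDistribution_mono (μ : Measure X) {r : ℝ} (hr : 0 ≤ r) {ε₁ ε₂ : ℝ} (h : ε₁ ≤ ε₂) :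
    massDistribution μ r ε₁ ≤ massDistribution μ r ε₂ := by
  refine sSup_le_sSup fun δ hδ ↦ ⟨hδ.1, ?_⟩
  calc μ (thinSet μ (ε₂ * r) δ) ≤ μ (thinSet μ (ε₁ * r) δ) :=
        measure_mono (thinSet_anti μ (mul_le_mul_of_nonneg_right h hr) δ)
    _ ≤ ENNReal.ofReal ε₁ := hδ.2
    _ ≤ ENNReal.ofReal ε₂ := ENNReal.ofReal_le_ofReal h

omit [BorelSpace X] in
/-- **The supremum in (2.6) is attained** (Bamler 2023, §2.5, Lemma):
`μ({x : μ(D(x, εr)) < b^{(X,d,μ)}_r(ε)}) ≤ ε` — continuity of the measure along the increasing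
union `{μ(D(x, εr)) < b₀} = ⋃_{δ ↑ b₀} {μ(D(x, εr)) < δ}`.
[cite: Bamler2023, §2.5, Lemma (properties of the mass distribution function)] -/
theorem measure_thinSet_massDistribution_le (μ : Measure X) (r ε : ℝ) :
    μ (thinSet μ (ε * r) (massDistribution μ r ε)) ≤ ENNReal.ofReal ε := by
  set b := massDistribution μ r ε with hb
  rcases eq_or_ne b 0 with hb0 | hb0
  · rw [hb0, thinSet_zero, measure_empty]
    exact bot_le
  -- a sequence `u n ↑ b`, `u n < b`
  obtain ⟨u, hu_mono, hu_mem, hu_lim⟩ := exists_seq_strictMono_tendsto' (pos_iff_ne_zero.2 hb0)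
  have hunion : thinSet μ (ε * r) b = ⋃ n, thinSet μ (ε * r) (u n) := by
    refine Subset.antisymm (fun x hx ↦ ?_) (iUnion_subset fun n ↦ thinSet_mono μ _ (hu_mem n).2.le)
    rw [mem_thinSet] at hx
    obtain ⟨n, hn⟩ := ((tendsto_order.1 hu_lim).1 _ hx).exists
    exact mem_iUnion.2 ⟨n, hn⟩
  have hmono : Monotone fun n ↦ thinSet μ (ε * r) (u n) := fun m n hmn ↦
    thinSet_mono μ _ (hu_mono.monotone hmn)
  rw [hunion, hmono.measure_iUnion]
  exact iSup_le fun n ↦ (mem_massDistribution_set_of_lt (hu_mem n).2).2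

omit [BorelSpace X] in
/-- **The criterion for `b^{(X,d,μ)}_r ≥ b`** (Bamler 2023, §2.5, Lemma, last statement, at a
fixed `ε`): for `β ≤ 1`, `β ≤ b^{(X,d,μ)}_r(ε) ↔ μ({x : μ(D(x, εr)) < β}) ≤ ε`.
[cite: Bamler2023, §2.5, Lemma (properties of the mass distribution function)] -/
theorem le_massDistribution_iff (μ : Measure X) (r ε : ℝ) {β : ℝ≥0∞} (hβ : β ≤ 1) :
    β ≤ massDistribution μ r ε ↔ μ (thinSet μ (ε * r) β) ≤ ENNReal.ofReal ε := by
  constructor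
  · intro h
    exact (measure_mono (thinSet_mono μ _ h)).trans (measure_thinSet_massDistribution_le μ r ε)
  · intro h
    exact le_sSup ⟨hβ, h⟩

end Literature.Geometry.Riemannian

end
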